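import Summits.Parity.GeneralizedHardyLittlewood.Theorems.FordMaynardSieveConst01651SieveConst01651CertAssembly
import Summits.Parity.GeneralizedHardyLittlewood.Theorems.FordMaynardSieveConst01651SieveConst01651PairingTwoCert
import HarnessLib

/-!
# Route `FordMaynardSieveConst01651`, target `SieveConst01651` (stmt-Parity-19185), line `sieve_decomposition` (v21):
# stub `stub_certValuePos` BY NAME

The v21 registered stub `stub_certValuePos` (R2, the positivity of the certificate value of the landed witness
`coneCert` at `ν₀ = 0.1651`): `0 < sieveBoundG1 (1651/10000) coneCert`.  Proof: the log-free Buchstab/Volterra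
integer certificate of lineage `fordmaynardsieveco-2` — cut form of `V` (`…BuchstabCuts`), the exact-integer Volterra
table enclosing Buchstab's `Φ₆` (`…BuchstabTable*`), the checker `certCheck` evaluated to `true` in the kernel
(`…BuchstabCertEval`), the reduction `…CertAssembly.stub_certValuePos_of_pairingTwo` to the single inequality
`(certP − certN)/D ≤ I₂`, and that inequality `…PairingTwoCert.cert_le_pairing_two` (per-entry rectangle soundness:
`…EntryRegion/EntryLower/EntryUpper`, swap symmetry `…PlaneSymm`).  Standard axioms, no `native_decide`.

References: [FordMaynard2024PrimeSieves] K. Ford, J. Maynard, *On the theory of prime producing sieves*,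
arXiv:2407.14368, Theorem 7.3 (a), §8.2.
-/

noncomputable section

open Literature.NumberTheory.Sieve Literature.NumberTheory.Sieve.FordMaynard

namespace Summit.Parity.GeneralizedHardyLittlewood.FordMaynardSieveConst01651SieveConst01651

/-- **Stub `stub_certValuePos` of line `sieve_decomposition` (v21), registered signature verbatim**: the sieve
bound `V(ν₀, coneCert)` of the cone-data witness `coneCert` at `ν₀ = 0.1651` is positive (certified value
`≥ 0.00208`, true value `0.0027065`).  Proof: `stub_certValuePos_of_pairingTwo cert_le_pairing_two`.
[cite: FordMaynard2024PrimeSieves, Theorem 7.3 (a), §8.2] -/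
theorem stub_certValuePos : 0 < sieveBoundG1 (1651 / 10000) coneCert :=
  stub_certValuePos_of_pairingTwo cert_le_pairing_two

end Summit.Parity.GeneralizedHardyLittlewood.FordMaynardSieveConst01651SieveConst01651

end
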